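import Mathlib
import HarnessLib
import Literature.NumberTheory.GaloisRepresentations.OrdinaryGaloisRep
import Literature.NumberTheory.GaloisRepresentations.EvenGaloisRep
import Literature.NumberTheory.GaloisRepresentations.CliffordTwistDichotomy
import Literature.NumberTheory.GaloisRepresentations.AbsGaloisRestrictSurjective
import Literature.NumberTheory.GaloisRepresentations.DegreeOnePlacesProofs
import Literature.NumberTheory.GaloisRepresentations.LocalGaloisGroupInertiaProofs
import Literature.NumberTheory.GaloisRepresentations.PadicComplexEmbedding
import Literature.NumberTheory.Automorphic.AdicCompletionDegreeOnePlaceProofs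
import Literature.NumberTheory.Automorphic.PairLFunctionBaseChange
import Literature.NumberTheory.QuadraticForms.HilbertSymbolRatOdd
import Literature.NumberTheory.EllipticCurves.ZpExtensionProofs

/-!
# `EvenSkinnerWilesMirror.MirrorEntry` — transport lemmas (item `stmt-Langlands-15310`, file 1/2)

Support file for the proof of the crux `MirrorEntry` of route `EvenSkinnerWilesMirror`
(closing theorem `mirrorEntry_proof` in `EvenSkinnerWilesMirrorMirrorEntry.lean`).  For an odd
prime `p`, a totally complex quadratic field `K` in which `p` splits, and a continuous
`ρ : Γ_ℚ → GL₂(ℚ̄_p)`, the entry data of the route (irreducibility, a.e. unramifiedness, an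
upper-triangular integral model, `p`-distinguishedness and an ordinary frame at the places above
`p`) are to be transported from `ρ` to `ρ|_{Γ_K}`.  This file proves the four ingredients that are
not already in the tree verbatim:

* **degree one** (`inertiaDeg_eq_one_of_residueCard_eq`, `ramificationIdx_eq_one_of_not_sq_dvd`):
  `N(w) = p` and `w² ∤ (p)` give `f(w|p) = e(w|p) = 1`, whence the local base change
  `ℚ_p → K_w` is onto and so is the restriction `Γ_{K_w} → Γ_{ℚ_p}`
  (`absGaloisRestrict_adicCompletion_surjective`);
* **inertia** is respected by `Γ_{K_w} → Γ_{ℚ_p}` (`absGaloisRestrict_mem_absInertia`, from the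
  tree's `absInertia_map_absGaloisRestrict_le_holds`);
* **Clifford + parity** (`isIrreducible_restrictField_of_isEven`): an irreducible EVEN
  `ρ : Γ_ℚ → GL₂(ℚ̄_p)` stays irreducible on `Γ_K` for `K` totally complex quadratic — were it
  reducible, `ρ ≅ ρ ⊗ χ_K` (`exists_twist_conj_of_not_isIrreducible_restrictField`), and evaluating
  at a complex conjugation `c ∉ Γ_K` (where `ρ(c) = ±1` is central by evenness and `χ_K(c) = -1`)
  gives `ρ(c) = -ρ(c)`, absurd (this is the «special = induced-from-`K`» versus «generic» dichotomy:
  an even irreducible `ρ` is never induced from an imaginary quadratic field);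
* **frames** (`v_mul_frame_le`): multiplying an ordinary frame `Q` (`v(Q₀₀) ≤ v(Q₁₀)`) on the left
  by an integral matrix that is upper triangular mod `𝔪` keeps `v(Q'₀₀) ≤ v(Q'₁₀)`;
  and `residualDiag` is a class function (`residualDiag_conj`).

No conjecture or named fact is used; no definition is introduced.
Ref: Serre, *Abelian ℓ-adic representations* (1968), Ch. I §2.1; Skinner–Wiles, *Residually
reducible representations and modular forms*, Publ. IHÉS 89 (1999), §1, §4.6; Clifford theory as in
Arthur–Clozel, *Simple algebras, base change…*, Ch. 3 Thm. 4.2 (a).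
(decomp-langlands lens-2, g30.)
-/

set_option linter.dupNamespace false -- project-wide option (lakefile weak.linter.dupNamespace); `Summit.Langlands.Langlands` is the mandated namespace

noncomputable section

namespace Summit.Langlands.Langlands.Theorems.EvenSkinnerWilesMirrorMirrorEntry

open Field NumberField IsDedekindDomain Rat.HeightOneSpectrum
open Literature.NumberTheory.GaloisRepresentations Literature.NumberTheory.Automorphic

/-! ### Degree-one places of a number field over `ℚ` -/

section DegreeOne

variable {K : Type} [Field K] [NumberField K]

/-- The place of `ℚ` below a place `w ∋ p` is `(p)`. [folklore] -/
theorem under_asIdeal_eq_span (w : HeightOneSpectrum (𝓞 K)) {p : ℕ} (hp : p.Prime)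
    (hw : (p : 𝓞 K) ∈ w.asIdeal) :
    (w.under (𝓞 ℚ)).asIdeal = Ideal.span {(p : 𝓞 ℚ)} := by
  rw [Literature.NumberTheory.QuadraticForms.RatPlace.asIdeal_eq_span_natGenerator,
    natGenerator_under_eq_of_natCast_mem w hp hw]

/-- `N(w) = p` forces residue degree `f(w|p) = 1` (since `N(w) = p ^ f`). [folklore] -/
theorem inertiaDeg_eq_one_of_residueCard_eq (w : HeightOneSpectrum (𝓞 K)) {p : ℕ} (hp : p.Prime)
    (hw : (p : 𝓞 K) ∈ w.asIdeal) (hcard : w.residueCard = p) :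
    w.asIdeal.inertiaDeg (𝓞 ℚ) = 1 := by
  have h := residueCard_eq_pow_inertiaDeg (F := ℚ) w
  rw [hcard, Rat.residueCard_eq_natGenerator, natGenerator_under_eq_of_natCast_mem w hp hw] at h
  exact Nat.pow_right_injective hp.two_le (by simpa using h.symm)

/-- `w² ∤ (p)` (with `p ∈ w`) forces ramification index `e(w|p) = 1`. [folklore] -/
theorem ramificationIdx_eq_one_of_not_sq_dvd (w : HeightOneSpectrum (𝓞 K)) {p : ℕ} (hp : p.Prime)
    (hw : (p : 𝓞 K) ∈ w.asIdeal) (hsq : ¬ w.asIdeal ^ 2 ∣ Ideal.span {(p : 𝓞 K)}) :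
    w.asIdeal.ramificationIdx (𝓞 ℚ) = 1 := by
  haveI : w.asIdeal.LiesOver (w.under (𝓞 ℚ)).asIdeal := ⟨rfl⟩
  have hmap : (w.under (𝓞 ℚ)).asIdeal.map (algebraMap (𝓞 ℚ) (𝓞 K)) =
      Ideal.span {(p : 𝓞 K)} := by
    rw [under_asIdeal_eq_span w hp hw, Ideal.map_span, Set.image_singleton, map_natCast]
  have hne : (w.under (𝓞 ℚ)).asIdeal.map (algebraMap (𝓞 ℚ) (𝓞 K)) ≠ ⊥ := by
    rw [hmap, Ne, Ideal.span_singleton_eq_bot]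
    exact_mod_cast hp.ne_zero
  rw [Ideal.IsDedekindDomain.ramificationIdx_eq_multiplicity (w.under (𝓞 ℚ)).asIdeal w.asIdeal
    hne, hmap]
  refine multiplicity_eq_of_dvd_of_not_dvd ?_ ?_
  · rw [pow_one, Ideal.dvd_span_singleton]
    exact hw
  · simpa using hsq

variable (K)

/-- **At a place of degree one `Γ_{K_w} → Γ_{ℚ_v}` is onto**: `e f = [K_w : ℚ_v] = 1`, so the
local base change `ℚ_v → K_w` is surjective (tree `surjective_adicCompletionOfLiesOver`), `ℚ_v` is
algebraically closed in `K_w`, and `absGaloisRestrict_surjective_of_isIntegrallyClosedIn` applies.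
[folklore] -/
theorem absGaloisRestrict_adicCompletion_surjective (v : HeightOneSpectrum (𝓞 ℚ))
    (w : HeightOneSpectrum (𝓞 K)) [w.asIdeal.LiesOver v.asIdeal]
    (he : w.asIdeal.ramificationIdx (𝓞 ℚ) = 1) (hf : w.asIdeal.inertiaDeg (𝓞 ℚ) = 1) :
    letI := (adicCompletionOfLiesOver ℚ K v w).toAlgebra
    Function.Surjective (absGaloisRestrict (v.adicCompletion ℚ) (w.adicCompletion K)) := by
  letI := (adicCompletionOfLiesOver ℚ K v w).toAlgebra
  have hsurj : Function.Surjective (algebraMap (v.adicCompletion ℚ) (w.adicCompletion K)) :=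
    surjective_adicCompletionOfLiesOver ℚ K v w he hf
  haveI : CharZero (w.adicCompletion K) :=
    charZero_of_injective_algebraMap (algebraMap K (w.adicCompletion K)).injective
  haveI : IsIntegrallyClosedIn (v.adicCompletion ℚ) (w.adicCompletion K) :=
    isIntegrallyClosedIn_iff.mpr
      ⟨(algebraMap (v.adicCompletion ℚ) (w.adicCompletion K)).injective, fun {x} _ => hsurj x⟩
  exact absGaloisRestrict_surjective_of_isIntegrallyClosedIn _ _

/-- **Inertia maps to inertia** under `Γ_{K_w} → Γ_{ℚ_v}` (tree
`absInertia_map_absGaloisRestrict_le_holds`). [folklore] -/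
theorem absGaloisRestrict_mem_absInertia (v : HeightOneSpectrum (𝓞 ℚ))
    (w : HeightOneSpectrum (𝓞 K)) [w.asIdeal.LiesOver v.asIdeal] :
    letI := (adicCompletionOfLiesOver ℚ K v w).toAlgebra
    ∀ σ ∈ absInertia (w.adicCompletion K),
      absGaloisRestrict (v.adicCompletion ℚ) (w.adicCompletion K) σ ∈
        absInertia (v.adicCompletion ℚ) := by
  letI := (adicCompletionOfLiesOver ℚ K v w).toAlgebra
  intro σ hσ
  have h : (absInertia (w.adicCompletion K)).map
      (absGaloisRestrict (v.adicCompletion ℚ) (w.adicCompletion K)).toMonoidHom ≤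
        absInertia (v.adicCompletion ℚ) :=
    absInertia_map_absGaloisRestrict_le_holds (v.adicCompletion ℚ) (w.adicCompletion K)
  exact h (Subgroup.mem_map_of_mem _ hσ)

end DegreeOne

/-! ### Residual diagonal characters are class functions -/

section Residual

variable {F : Type*} [Field F] {O : ValuationSubring F} {G : Type*} [Group G]

/-- For a residually upper-triangular `ρ₀ : G → GL₂(O)`, each residual diagonal entry is a
character, hence invariant under conjugation: `χ̄ᵢ(τ g τ⁻¹) = χ̄ᵢ(g)`. [folklore] -/
theorem residualDiag_conj {ρ₀ : G →* GL (Fin 2) O} (h : IsResiduallyUpperTriangular ρ₀)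
    (i : Fin 2) (τ g : G) :
    residualDiag ρ₀ i (τ * g * τ⁻¹) = residualDiag ρ₀ i g := by
  rw [← h.residualChar_apply, ← h.residualChar_apply, map_mul, map_mul, mul_right_comm,
    ← map_mul, mul_inv_cancel, map_one, one_mul]

end Residual

/-! ### The valuation ring of `ℚ̄_p` and ordinary frames -/

section Frame

variable {p : ℕ} [Fact p.Prime] {O : ValuationSubring (PadicAlgCl p)}

/-- Elements of the valuation ring have valuation `≤ 1`. [folklore] -/
theorem v_coe_le_one (hO : O = (Valued.v : Valuation (PadicAlgCl p) NNReal).valuationSubring)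
    (x : O) : Valued.v (x : PadicAlgCl p) ≤ 1 := by
  subst hO
  exact x.2

/-- Elements of the maximal ideal have valuation `< 1`. [folklore] -/
theorem v_coe_lt_one_of_mem
    (hO : O = (Valued.v : Valuation (PadicAlgCl p) NNReal).valuationSubring) {x : O}
    (hx : x ∈ IsLocalRing.maximalIdeal O) : Valued.v (x : PadicAlgCl p) < 1 := by
  subst hO
  exact (Valuation.mem_maximalIdeal_iff (PadicAlgCl p) Valued.v).mp hx

/-- Units of the valuation ring have valuation `1`. [folklore] -/
theorem v_coe_eq_one_of_isUnit
    (hO : O = (Valued.v : Valuation (PadicAlgCl p) NNReal).valuationSubring) {x : O}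
    (hx : IsUnit x) : Valued.v (x : PadicAlgCl p) = 1 := by
  subst hO
  exact Valuation.Integers.one_of_isUnit (Valuation.valuationSubring.integers _) hx

/-- In an integral matrix that is upper triangular mod `𝔪`, the lower-right entry is a unit:
`v(M₁₁) = 1` (`det M = M₀₀ M₁₁ - M₀₁ M₁₀` is a unit and `v(M₀₁ M₁₀) < 1`). [folklore] -/
theorem v_coe_one_one_eq_one
    (hO : O = (Valued.v : Valuation (PadicAlgCl p) NNReal).valuationSubring)
    (M : GL (Fin 2) O) (hM : M.val 1 0 ∈ IsLocalRing.maximalIdeal O) :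
    Valued.v ((M.val 1 1 : O) : PadicAlgCl p) = 1 := by
  have ha := v_coe_le_one hO (M.val 0 0)
  have hb := v_coe_le_one hO (M.val 0 1)
  have hc := v_coe_lt_one_of_mem hO hM
  have hd := v_coe_le_one hO (M.val 1 1)
  have hu : IsUnit (M.val 0 0 * M.val 1 1 - M.val 0 1 * M.val 1 0) := by
    rw [← Matrix.det_fin_two]
    exact (Matrix.isUnit_iff_isUnit_det _).mp M.isUnit
  have hdet := v_coe_eq_one_of_isUnit hO hu
  by_contra hne
  have hlt : Valued.v ((M.val 1 1 : O) : PadicAlgCl p) < 1 := lt_of_le_of_ne hd hne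
  refine absurd hdet (ne_of_lt ?_)
  push_cast
  refine lt_of_le_of_lt (Valuation.map_sub _ _ _) (max_lt ?_ ?_)
  · rw [Valuation.map_mul]
    exact mul_lt_one_of_nonneg_of_lt_one_right ha zero_le hlt
  · rw [Valuation.map_mul]
    exact mul_lt_one_of_nonneg_of_lt_one_right hb zero_le hc

/-- **Ordinary frames are stable under integral, residually upper-triangular change of basis.**
If `Q ∈ GL₂(ℚ̄_p)` satisfies `v(Q₀₀) ≤ v(Q₁₀)` and `M ∈ GL₂(O)` has `M₁₀ ∈ 𝔪`, then
`Q' = M Q` satisfies `v(Q'₀₀) ≤ v(Q'₁₀)`: indeed `v(Q'₁₀) = v(M₁₀ Q₀₀ + M₁₁ Q₁₀) = v(Q₁₀)`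
(`M₁₁` is a unit, `v(M₁₀ Q₀₀) < v(Q₁₀)`), while `v(Q'₀₀) ≤ max (v Q₀₀) (v Q₁₀)`. [folklore] -/
theorem v_mul_frame_le
    (hO : O = (Valued.v : Valuation (PadicAlgCl p) NNReal).valuationSubring)
    (M : GL (Fin 2) O) (hM : M.val 1 0 ∈ IsLocalRing.maximalIdeal O)
    (Q : GL (Fin 2) (PadicAlgCl p)) (hQ : Valued.v (Q.val 0 0) ≤ Valued.v (Q.val 1 0)) :
    Valued.v ((Matrix.GeneralLinearGroup.map O.subtype M * Q).val 0 0) ≤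
      Valued.v ((Matrix.GeneralLinearGroup.map O.subtype M * Q).val 1 0) := by
  have ha := v_coe_le_one hO (M.val 0 0)
  have hb := v_coe_le_one hO (M.val 0 1)
  have hc := v_coe_lt_one_of_mem hO hM
  have hd := v_coe_one_one_eq_one hO M hM
  have hentry : ∀ i, (Matrix.GeneralLinearGroup.map O.subtype M * Q).val i 0 =
      ((M.val i 0 : O) : PadicAlgCl p) * Q.val 0 0 + ((M.val i 1 : O) : PadicAlgCl p) * Q.val 1 0 := by
    intro i
    rw [Units.val_mul, Matrix.mul_apply, Fin.sum_univ_two]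
    rfl
  have hQ10 : Q.val 1 0 ≠ 0 := by
    intro h0
    have h00 : Q.val 0 0 = 0 := by
      rw [h0, Valuation.map_zero, le_zero_iff] at hQ
      exact (Valuation.zero_iff _).mp hQ
    have hcol : ∀ i, Q.val i 0 = 0 := fun i => by
      fin_cases i
      · exact h00
      · exact h0
    exact ((Matrix.isUnit_iff_isUnit_det _).mp Q.isUnit).ne_zero
      (Matrix.det_eq_zero_of_column_eq_zero 0 hcol)
  have hpos : 0 < Valued.v (Q.val 1 0) := (Valuation.pos_iff _).mpr hQ10
  have hlt : Valued.v (((M.val 1 0 : O) : PadicAlgCl p) * Q.val 0 0) < Valued.v (Q.val 1 0) := by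
    rw [Valuation.map_mul]
    rcases eq_or_ne (Q.val 0 0) 0 with h0 | h0
    · rw [h0, Valuation.map_zero, mul_zero]
      exact hpos
    · exact (mul_lt_of_lt_one_left ((Valuation.pos_iff _).mpr h0) hc).trans_le hQ
  have h10 : Valued.v ((Matrix.GeneralLinearGroup.map O.subtype M * Q).val 1 0) =
      Valued.v (Q.val 1 0) := by
    rw [hentry 1, Valuation.map_add_eq_of_lt_right]
    · rw [Valuation.map_mul, hd, one_mul]
    · rw [Valuation.map_mul _ ((M.val 1 1 : O) : PadicAlgCl p), hd, one_mul]
      exact hlt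
  rw [h10, hentry 0]
  refine le_trans (Valuation.map_add _ _ _) (max_le ?_ ?_)
  · rw [Valuation.map_mul]
    exact (mul_le_of_le_one_left zero_le ha).trans hQ
  · rw [Valuation.map_mul]
    exact mul_le_of_le_one_left zero_le hb

end Frame

/-! ### Clifford + parity: even irreducible `ρ` stays irreducible on an imaginary quadratic `Γ_K` -/

section Clifford

variable {p : ℕ} [Fact p.Prime]

/-- **An even irreducible `ρ : Γ_ℚ → GL₂(ℚ̄_p)` restricts irreducibly to `Γ_K`, `K` totally complex
quadratic.**  Otherwise Clifford theory (`exists_twist_conj_of_not_isIrreducible_restrictField`,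
`Gal(K/ℚ)` cyclic) gives `P ρ P⁻¹ = ρ ⊗ χ` with `χ ≠ 1` trivial on `Γ_K`; as `[Γ_ℚ : Γ_K] = 2`
and a complex conjugation `c` is not in `Γ_K` (`K` totally complex), `χ(c) ≠ 1`, so `χ(c) = -1`
(`c² = 1`); but `ρ(c) = ±1` is central (`ρ` even, rank `2`), so `ρ(c) = P ρ(c) P⁻¹ = -ρ(c)`,
i.e. `2 = 0` in `ℚ̄_p` — absurd. [folklore] -/
theorem isIrreducible_restrictField_of_isEven (ρ : FramedGaloisRep ℚ (PadicAlgCl p) 2)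
    (hirr : ρ.toGaloisRep.IsIrreducible) (heven : ρ.IsEven) (K : Type) [Field K] [NumberField K]
    (hKc : NumberField.IsTotallyComplex K) (hK2 : Module.finrank ℚ K = 2) :
    (ρ.restrictField K).toGaloisRep.IsIrreducible := by
  by_contra hred
  haveI : Algebra.IsQuadraticExtension ℚ K := { finrank_eq_two' := hK2 }
  haveI : IsGalois ℚ K := inferInstance
  haveI : IsCyclic (K ≃ₐ[ℚ] K) :=
    isCyclic_of_prime_card (p := 2) (by rw [IsGalois.card_aut_eq_finrank, hK2])
  obtain ⟨χ, P, hχK, hχ1, hconj⟩ :=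
    ρ.exists_twist_conj_of_not_isIrreducible_restrictField (M := K) hirr hred
  -- a complex conjugation `c ∉ Γ_K`
  obtain ⟨c, hc⟩ := exists_isComplexConjugation (Rat.castHom ℝ)
  have hcK : c ∉ Set.range (absGaloisRestrict ℚ K) :=
    hc.not_mem_range_absGaloisRestrict (L := K) fun w => hKc.isComplex w
  have hcc : c * c = 1 := by rw [← pow_two]; exact hc.sq_eq_one
  -- `χ` is `1` on `Γ_K`, so `χ(c) ≠ 1` (else `χ = 1`: every `g ∉ Γ_K` is `c · (c⁻¹ g)`, `c⁻¹ g ∈ Γ_K`)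
  have hχc : χ c ≠ 1 := by
    intro h1
    apply hχ1
    ext g : 1
    change χ g = 1
    by_cases hg : g ∈ Set.range (absGaloisRestrict ℚ K)
    · obtain ⟨σ, rfl⟩ := hg
      exact hχK σ
    · obtain ⟨σ, hσ⟩ :=
        Literature.NumberTheory.EllipticCurves.inv_mul_mem_range_absGaloisRestrict hK2 hcK hg
      have : g = c * absGaloisRestrict ℚ K σ := by rw [hσ, mul_inv_cancel_left]
      rw [this, map_mul, h1, hχK σ, one_mul]
  -- `χ(c)² = 1`, so `χ(c) = -1` in `ℚ̄_p`
  have hχc' : ((χ c : (PadicAlgCl p)ˣ) : PadicAlgCl p) = -1 := by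
    have hsq : ((χ c : (PadicAlgCl p)ˣ) : PadicAlgCl p) ^ 2 = 1 := by
      rw [← Units.val_pow_eq_pow_val, ← map_pow, pow_two, hcc, map_one, Units.val_one]
    rcases sq_eq_one_iff.mp hsq with h | h
    · exact absurd (Units.ext h) hχc
    · exact h
  -- `ρ(c) = ±1` is central, so `P ρ(c) P⁻¹ = ρ(c)`; but it is also `χ(c) ρ(c) = -ρ(c)`
  have h2 : (2 : PadicAlgCl p) ≠ 0 := two_ne_zero
  have hρc := (FramedGaloisRep.isEven_iff_eq_one_or_eq_neg_one h2 ρ).mp heven _ c hc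
  have hcentral : P * ρ c * P⁻¹ = ρ c := by
    rcases hρc with h | h <;> rw [h]
    · rw [mul_one, mul_inv_cancel]
    · rw [mul_neg, mul_one, neg_mul, mul_inv_cancel]
  have hPc : P * ρ c * P⁻¹ = FramedRep.scalar (PadicAlgCl p) 2 (χ c) * ρ c := by
    have h := congrArg (fun (τ : FramedRep (absoluteGaloisGroup ℚ) (PadicAlgCl p) 2) => τ c) hconj
    simpa only [FramedRep.conj_apply, FramedRep.twist_apply] using h
  rw [hcentral] at hPc
  have hs : FramedRep.scalar (PadicAlgCl p) 2 (χ c) = 1 :=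
    mul_right_cancel (hPc.symm.trans (one_mul (ρ c)).symm)
  -- compare the `(0,0)` entries: `-1 = 1` in `ℚ̄_p`
  have h00 := congrArg
    (fun (g : GL (Fin 2) (PadicAlgCl p)) => (g : Matrix (Fin 2) (Fin 2) (PadicAlgCl p)) 0 0) hs
  simp only [FramedRep.coe_scalar_apply, Matrix.algebraMap_matrix_apply, if_true, hχc',
    Units.val_one, Matrix.one_apply_eq, Algebra.algebraMap_self, RingHom.id_apply] at h00
  exact h2 (by linear_combination (-1 : PadicAlgCl p) * h00)

end Clifford

end Summit.Langlands.Langlands.Theorems.EvenSkinnerWilesMirrorMirrorEntry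

end
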